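import Summits.QuantumFields.BalabanUV.Beta.FP.PerfectStencilFixedPoint
import Summits.QuantumFields.BalabanUV.Beta.FP.SymJetDressingUnits
import Summits.QuantumFields.BalabanUV.Beta.FP.PerfectObjectsT
import Summits.QuantumFields.BalabanUV.Beta.GAN24.KSlotAssembly
import Summits.QuantumFields.BalabanUV.Beta.GAN24.WSlotCauchyOfShapes
import Summits.QuantumFields.BalabanUV.Beta.HessKerConvCKPlug

/-!
# `BalabanUV.Beta.FP.PerfectStencilFixedPointSym` — road «FP» for binder row D1, row **N1-J∞-S** (corollary C, `LEAVES-FP.md` l.547; owner d1-p3 gen 12,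
# GO l.31280): THE FIXED-POINT EQUATION FOR THE (0.4) LITERAL `JsB12Sym`, `d + 1 = 4`, `Lc ≥ 2` — K-slot AND G-slot DISCHARGED
# (`KSlotAssembly.convCKWall_holds`, `SymDressingUnits`), displayed: the table shapes (ShV)(ShH) and the (CONV-C)-S rows `hS0 hSall0` VERBATIM as in the END

HONEST DEPENDENCY (page 1, mandatory): continuum YM on T⁴ ⇐ BetaPertH ∧ nine spine estimates (0/9 proved); BetaPertH ⇐ (D1) ∧ (D4) ∧ CAP+tail;
G-an2-4 gates asym, D1 and NE2/3/4.  HONEST FRAMING (cell contract, verbatim): «discharging `BetaPertH` makes Bałaban's UV stability UNCONDITIONAL —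
a real constructive-QFT result; it is NOT the continuum limit and NOT the Clay problem.»  ABSOLUTE RULE (cell, verbatim): «No internally-minted
statement may enter as a cited fact. Every hypothesis is either kernel-proved in this package or a verbatim quotation of a PUBLISHED theorem with page
reference.»  Nothing is cited; no `def`, no `def … : Prop`; no wall binder instantiated; no existing file touched.  NOT IN PRINT; OUR BOOKKEEPING.

## What is proved (`d = 3`; `2 ≤ Lc`, `Odd Lc`; tables `tabs : SymTables 3 Lc`, free `cΛ cB`, colour count `N`)
The literal's undressed stencil family is `(JsB12Sym0 hOdd N tabs cΛ cB j).S = SsymOf tabs (Lc⁴) (−Lc⁸∕2) cΛ j = SrecOf 3 Lc tabs.V tabs.H (Gsym Lc) (Lc⁴) (−Lc⁸∕2) cΛ j`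
(`rfl`), and the literal of record is its (0.4) dressing: `unitS sf sm (JsB12Sym … j).S = 𝔇 (unitS sf sm (JsB12Sym0 … j).S)`,
`𝔇 S := fun κ u ↦ dressKSymAt ρ_c Lc (coProjSymAtK ρ_c Lc S κ u)` (`SymJetDressingUnits.unitS_dressSym`, `RoadEndLeftUndressed.unitS_JsB12Sym_eq_dress`).
* §1 **`limStOf_unitS_JsB12Sym0_S_eq`** (C1) — with `S̃⁰ j := unitS (sfStep Lc j) (smStep 3 Lc j) (JsB12Sym0 … j).S`, `S∞⁰ := limStOf S̃⁰`, `K₁ := KPerf Lc (sfStep Lc) (smStep 3 Lc) 1`,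
  `G∞ := coDressKSymAt ρ_c Lc K₁`:  (ShV)(ShH) + `hS0 hSall0 hδS hθS0 hθS1` ⊢
  `S∞⁰ = fun κ u ↦ (Lc⁴·Lc⁸) • e3OfK Lc G∞ S∞⁰ κ u + (−Lc⁸∕2) • tabs.V κ u + (cΛ·Lc⁸) • SLam Lc (lamCoeffK K₁ (mmRead Lc K₁) Lc) tabs.H κ u` —
  the K-slot rate data from `convCKWall_holds` + asym1's `decays_limMKerOf`∕`decays_sub_limMKerOf` (`KPerf_one`), the G-slot rate data from the owner's
  `SymDressingUnits.coDressKSymAt_unitK`∕`decays_coDressKSymAt_explicit`∕`decays_rate_coDressKSymAt`, (LH₀) from `tabs.hH` at rate `0`, all currencies merged to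
  `m := min (δ_K∕4) δS`, `θ := max θ_K θS` by monotonicity (`HessKerConvCKPlug.locStencil_mono'`, `WSlotCauchyOfShapes.mul_pow_le_mul_pow`); then `PerfectStencilFixedPoint.limStOf_unitS_SrecOf_eq`.
* §2 **`SPerfOf_JsB12Sym_S_one_eq_dress`** (C2) — `hS0 hSall0 hδS hθS0 hθS1` ⊢ `SPerfOf (sfStep Lc) (smStep 3 Lc) (fun j _ ↦ (JsB12Sym … j).S) 1 = 𝔇 S∞⁰`
  (`PerfectObjectsT.SPerfOf_one` + the owner's `SymJetDressingUnits.limStOf_dressSym_unitS_eq`): the row's `S∞` IS the dressing of the fixed point of (C1).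
HONEST: discharges NO (CONV-C)-S row and NO table letter ((ShV)(ShH) are letters, R-FP-43); NOT N2, NOT D1, NOT `BetaPertH`, NOT continuum, NOT Clay.
-/

noncomputable section

open Finset Filter Topology
open scoped BigOperators
open Literature.MathematicalPhysics.QuantumFieldTheory
open Literature.MathematicalPhysics.QuantumFieldTheory.Balaban1983to89
open Literature.MathematicalPhysics.QuantumFieldTheory.Balaban1983to89.Beta
open B12Sec2to5 (l1 l1_nonneg)
open ExpKernelCalculus (MKer Decays BiLoc VertexFamily Zl)
open OneStepResolventKernel (Fib LocStencil decays_mono)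
open OneStepKernelFamily (KInvStep)
open AffineAveraging (box toSite)
open InterLevelTransport (SLam)
open BalabanStepJets (locStencil_mono)
open BalabanStepJetsSucc (mmRead lamCoeffK)
open HessKerDressedLimit (limMKerOf limStOf locStencil_limStOf locStencil_sub_limStOf decays_limMKerOf decays_sub_limMKerOf)
open Summit.QuantumFields.BalabanUV.Beta.HessKerDressedUnits (unitK unitS)
open Summit.QuantumFields.BalabanUV.Beta.DecayingKernelNeumann (decays_congr_const)
open Summit.QuantumFields.BalabanUV.Beta.GAN24.CombesThomas (sfStep smStep KStepUnit UnitDecayK CauchyDecayK ConvCKWall)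
open Summit.QuantumFields.BalabanUV.Beta.GAN24.KSlotAssembly (convCKWall_holds)
open Summit.QuantumFields.BalabanUV.Beta.GAN24.WSlotCauchyOfShapes (mul_pow_le_mul_pow)
open Summit.QuantumFields.BalabanUV.Beta.HessKerConvCKPlug (locStencil_mono')
open AveragingContoursRooted (ctrOff ctrOff_mem_box)
open Summit.QuantumFields.BalabanUV.Beta.AxialDressingRooted (cPb)
open Summit.QuantumFields.BalabanUV.Beta.SymmetrisedDressingKernel (dressKSymAt coDressKSymAt)
open Summit.QuantumFields.BalabanUV.Beta.SymmetrisedDressingDress (coProjSymAtK dressSymAt dressSymAt_S)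
open Summit.QuantumFields.BalabanUV.Beta.FP.SymDressingUnits (coDressKSymAt_unitK decays_coDressKSymAt_explicit decays_rate_coDressKSymAt)
open Summit.QuantumFields.BalabanUV.Beta.FP.SymJetDressingUnits (limStOf_dressSym_unitS_eq unitS_dressSym)
open Summit.QuantumFields.BalabanUV.Beta.FP.PerfectObjectsT (KPerf SPerfOf KPerf_one SPerfOf_one)
open Summit.QuantumFields.BalabanUV.Beta.SpineRooted (e3OfK)
open Summit.QuantumFields.BalabanUV.Beta.WardLocusRecursive (SrecOf)
open Summit.QuantumFields.BalabanUV.Beta.SymmetrisedStepJets (SymTables Gsym Gsym_apply SsymOf SsymOf_eq JsSym0Of_S JsB12Sym0 JsB12Sym0_eq JsB12Sym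
  JsB12Sym_apply)
open Summit.QuantumFields.BalabanUV.Beta.FP.PerfectStencilFixedPoint (limStOf_unitS_SrecOf_eq)

namespace Summit.QuantumFields.BalabanUV.Beta.FP.PerfectStencilFixedPointSym

/-! ## §1 (C1) The fixed-point equation for the undressed literal family, K- and G-slot discharged -/

section Literal

variable {Lc : ℕ} [NeZero Lc]

/-- [folklore] The undressed literal's stencils ARE the slotted recursion at the pins `(cE, cVH) = (Lc⁴, −Lc⁸∕2)` over `(tabs.V, tabs.H, Gsym Lc)` (`rfl`). -/
theorem JsB12Sym0_S_eq_SrecOf (hOdd : Odd Lc) (N : ℕ) (tabs : SymTables 3 Lc) (cΛ cB : ℝ) (j : ℕ) :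
    (JsB12Sym0 hOdd N tabs cΛ cB j).S = SrecOf 3 Lc tabs.V tabs.H (Gsym Lc) ((Lc : ℝ) ^ 4) (-((Lc : ℝ) ^ 8 / 2)) cΛ j := by
  rw [JsB12Sym0_eq, JsSym0Of_S, SsymOf_eq]

/-- [folklore] The unit-rescaled G-slot of the literal IS the co-dressing of the K-slot's unit step resolvent (`SymDressingUnits.coDressKSymAt_unitK`). -/
theorem unitK_Gsym_eq (j : ℕ) :
    unitK (sfStep Lc j) (smStep 3 Lc j) (Gsym (d := 3) Lc j) = coDressKSymAt (toSite (ctrOff (3 + 1) Lc)) Lc (KStepUnit (d := 3) Lc j) := by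
  rw [Gsym_apply]
  exact (coDressKSymAt_unitK _ _ _ _ _).symm

/-- [our object] **(C1) ROW N1-J∞-S FOR THE (0.4) LITERAL — THE UNDRESSED PERFECT STENCIL IS A FIXED POINT OF THE RESCALED STEP**, `d + 1 = 4`, `2 ≤ Lc`:
with `S̃⁰ j := unitS (sfStep Lc j) (smStep 3 Lc j) (JsB12Sym0 hOdd N tabs cΛ cB j).S`, `K₁ := KPerf Lc (sfStep Lc) (smStep 3 Lc) 1` and
`G∞ := coDressKSymAt ρ_c Lc K₁` (centred root), under the table SHAPE letters (ShV)(ShH) (R-FP-43) and the END's (CONV-C)-S rows `hS0 hSall0` (+ `hδS hθS0 hθS1`):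
`limStOf S̃⁰ = fun κ u ↦ (Lc⁴·Lc⁸) • e3OfK Lc G∞ (limStOf S̃⁰) κ u + (−Lc⁸∕2) • tabs.V κ u + (cΛ·Lc⁸) • SLam Lc (lamCoeffK K₁ (mmRead Lc K₁) Lc) tabs.H κ u`.
The K-slot (`KSlotAssembly.convCKWall_holds`) and the G-slot (`SymDressingUnits`) are DISCHARGED; the sup bound of `tabs.H` is `tabs.hH` at rate `0`. -/
theorem limStOf_unitS_JsB12Sym0_S_eq (hLc : 2 ≤ Lc) (hOdd : Odd Lc) (N : ℕ) (tabs : SymTables 3 Lc) (cΛ cB : ℝ)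
    (hVff : ∀ κ u x y (α β : Fin (3 + 1)), tabs.V κ u x y (Sum.inl α) (Sum.inl β) = 0)
    (hVmm : ∀ κ u x y (μ ν : Fin (3 + 1)), tabs.V κ u x y (Sum.inr μ) (Sum.inr ν) = 0)
    (hHfm : ∀ μ y x z (α ν : Fin (3 + 1)), tabs.H μ y x z (Sum.inl α) (Sum.inr ν) = 0)
    (hHm : ∀ μ y x z (ν : Fin (3 + 1)) (b : Fib 3), tabs.H μ y x z (Sum.inr ν) b = 0)
    {Cs0 cS δS θS : ℝ}
    (hS0 : ∀ j, LocStencil (unitS (sfStep Lc j) (smStep 3 Lc j) (JsB12Sym0 hOdd N tabs cΛ cB j).S) Cs0 δS)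
    (hSall0 : ∀ k j, LocStencil (unitS (sfStep Lc (k + j)) (smStep 3 Lc (k + j)) (JsB12Sym0 hOdd N tabs cΛ cB (k + j)).S -
      unitS (sfStep Lc k) (smStep 3 Lc k) (JsB12Sym0 hOdd N tabs cΛ cB k).S) (cS * θS ^ k) δS)
    (hδS : 0 < δS) (hθS0 : 0 ≤ θS) (hθS1 : θS < 1) :
    limStOf (fun j => unitS (sfStep Lc j) (smStep 3 Lc j) (JsB12Sym0 hOdd N tabs cΛ cB j).S) = fun κ u =>
      ((Lc : ℝ) ^ 4 * (Lc : ℝ) ^ (2 * (3 + 1))) •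
          e3OfK Lc (coDressKSymAt (toSite (ctrOff (3 + 1) Lc)) Lc (KPerf (d := 3) Lc (sfStep Lc) (smStep 3 Lc) 1))
            (limStOf (fun j => unitS (sfStep Lc j) (smStep 3 Lc j) (JsB12Sym0 hOdd N tabs cΛ cB j).S)) κ u +
        (-((Lc : ℝ) ^ 8 / 2)) • tabs.V κ u +
        (cΛ * (Lc : ℝ) ^ (2 * (3 + 1))) •
          SLam Lc (lamCoeffK (KPerf (d := 3) Lc (sfStep Lc) (smStep 3 Lc) 1) (mmRead Lc (KPerf (d := 3) Lc (sfStep Lc) (smStep 3 Lc) 1)) Lc) tabs.H κ u := by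
  have hLc1 : 1 ≤ Lc := le_trans (by norm_num) hLc
  have hr : ctrOff (3 + 1) Lc ∈ box (3 + 1) Lc := ctrOff_mem_box hLc1
  -- the K-slot of record (G-an2-4, d = 3, Lc ≥ 2)
  obtain ⟨C, δ, cK, θ, hδ, hθ0, hθ1, hUD, hCD⟩ := convCKWall_holds (Lc := Lc) hLc
  have hK : ∀ j, Decays (KStepUnit (d := 3) Lc j) C δ := hUD
  have hKall : ∀ k j, Decays (KStepUnit (d := 3) Lc (k + j) - KStepUnit (d := 3) Lc k) (cK * θ ^ k) δ := hCD
  set K₁ : MKer (3 + 1) (Fib 3) := KPerf (d := 3) Lc (sfStep Lc) (smStep 3 Lc) 1 with hK₁def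
  have hK₁ : K₁ = limMKerOf (fun j => KStepUnit (d := 3) Lc j) := KPerf_one Lc (sfStep Lc) (smStep 3 Lc)
  have hKinf : Decays K₁ C δ := by rw [hK₁]; exact decays_limMKerOf hK hKall hθ1
  have hKrate : ∀ k, Decays (KStepUnit (d := 3) Lc k - K₁) (cK * θ ^ k) δ := fun k => by rw [hK₁]; exact decays_sub_limMKerOf hKall hθ1 k
  have hC0 : 0 ≤ C := (hK 0).nonneg (Sum.inl 0)
  have hcK0 : 0 ≤ cK := by have h := (hKall 0 0).nonneg (Sum.inl 0); simpa using h
  -- the G-slot: the co-dressing transports bound, limit and rate (constants displayed by `SymDressingUnits`)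
  set CG : ℝ := (Fintype.card (Fib 3) : ℝ) * ((Fintype.card (Fib 3) : ℝ) * (cPb 3 Lc δ * C) * Zl (3 + 1) (δ - δ / 2) * cPb 3 Lc (δ / 2))
    * Zl (3 + 1) (δ / 2 - δ / 4) with hCGdef
  set cG : ℝ := ((Fintype.card (Fib 3) : ℝ) * ((Fintype.card (Fib 3) : ℝ) * (cPb 3 Lc δ) * Zl (3 + 1) (δ - δ / 2) * cPb 3 Lc (δ / 2))
    * Zl (3 + 1) (δ / 2 - δ / 4)) * cK with hcGdef
  have hG : ∀ j, Decays (unitK (sfStep Lc j) (smStep 3 Lc j) (Gsym (d := 3) Lc j)) CG (δ / 4) := fun j => by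
    rw [unitK_Gsym_eq]; exact decays_coDressKSymAt_explicit hLc1 hr hδ (hK j)
  have hGinf : Decays (coDressKSymAt (toSite (ctrOff (3 + 1) Lc)) Lc K₁) CG (δ / 4) := decays_coDressKSymAt_explicit hLc1 hr hδ hKinf
  have hGrate : ∀ j, Decays (unitK (sfStep Lc j) (smStep 3 Lc j) (Gsym (d := 3) Lc j) - coDressKSymAt (toSite (ctrOff (3 + 1) Lc)) Lc K₁)
      (cG * θ ^ j) (δ / 4) := fun j => by
    rw [unitK_Gsym_eq]
    exact decays_congr_const (decays_rate_coDressKSymAt hLc1 hr hδ hK hKinf hKrate j) (by rw [hcGdef]; ring)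
  have hCG0 : 0 ≤ CG := (hG 0).nonneg (Sum.inl 0)
  have hcG0 : 0 ≤ cG := by have h := (hGrate 0).nonneg (Sum.inl 0); simpa using h
  -- one currency: rate `m := min (δ/4) δS`, ratio `θ' := max θ θS`
  set m : ℝ := min (δ / 4) δS with hmdef
  set θ' : ℝ := max θ θS with hθ'def
  have hm : 0 < m := lt_min (by linarith) hδS
  have hmδ : m ≤ δ := (min_le_left _ _).trans (by linarith)
  have hmδ4 : m ≤ δ / 4 := min_le_left _ _
  have hmδS : m ≤ δS := min_le_right _ _
  have hθ'0 : 0 ≤ θ' := hθ0.trans (le_max_left _ _)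
  have hθ'1 : θ' < 1 := max_lt hθ1 hθS1
  have hCs0 : 0 ≤ Cs0 := (hS0 0 0 0).nonneg (Sum.inl 0)
  have hcS0 : 0 ≤ cS := by have h := (hSall0 0 0 0 0).nonneg (Sum.inl 0); simpa using h
  have hK' : ∀ j, Decays (KStepUnit (d := 3) Lc j) (max C CG) m := fun j => decays_mono (hK j) hC0 (le_max_left _ _) hmδ
  have hKinf' : Decays K₁ (max C CG) m := decays_mono hKinf hC0 (le_max_left _ _) hmδ
  have hKrate' : ∀ j, Decays (KStepUnit (d := 3) Lc j - K₁) (max cK cG * θ' ^ j) m := fun j =>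
    decays_mono (hKrate j) (mul_nonneg hcK0 (pow_nonneg hθ0 j))
      ((mul_pow_le_mul_pow hcK0 hθ0 (le_max_left _ _) j).trans (mul_le_mul_of_nonneg_right (le_max_left _ _) (pow_nonneg hθ'0 j))) hmδ
  have hG' : ∀ j, Decays (unitK (sfStep Lc j) (smStep 3 Lc j) (Gsym (d := 3) Lc j)) (max C CG) m := fun j =>
    decays_mono (hG j) hCG0 (le_max_right _ _) hmδ4
  have hGinf' : Decays (coDressKSymAt (toSite (ctrOff (3 + 1) Lc)) Lc K₁) (max C CG) m := decays_mono hGinf hCG0 (le_max_right _ _) hmδ4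
  have hGrate' : ∀ j, Decays (unitK (sfStep Lc j) (smStep 3 Lc j) (Gsym (d := 3) Lc j) - coDressKSymAt (toSite (ctrOff (3 + 1) Lc)) Lc K₁)
      (max cK cG * θ' ^ j) m := fun j =>
    decays_mono (hGrate j) (mul_nonneg hcG0 (pow_nonneg hθ0 j))
      ((mul_pow_le_mul_pow hcG0 hθ0 (le_max_left _ _) j).trans (mul_le_mul_of_nonneg_right (le_max_right _ _) (pow_nonneg hθ'0 j))) hmδ4
  have hS0' : ∀ j, LocStencil (unitS (sfStep Lc j) (smStep 3 Lc j)
      (SrecOf 3 Lc tabs.V tabs.H (Gsym Lc) ((Lc : ℝ) ^ 4) (-((Lc : ℝ) ^ 8 / 2)) cΛ j)) Cs0 m := fun j => by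
    rw [← JsB12Sym0_S_eq_SrecOf hOdd N tabs cΛ cB j]; exact locStencil_mono (hS0 j) hCs0 hmδS
  have hSall0' : ∀ k j, LocStencil (unitS (sfStep Lc (k + j)) (smStep 3 Lc (k + j))
      (SrecOf 3 Lc tabs.V tabs.H (Gsym Lc) ((Lc : ℝ) ^ 4) (-((Lc : ℝ) ^ 8 / 2)) cΛ (k + j)) -
        unitS (sfStep Lc k) (smStep 3 Lc k) (SrecOf 3 Lc tabs.V tabs.H (Gsym Lc) ((Lc : ℝ) ^ 4) (-((Lc : ℝ) ^ 8 / 2)) cΛ k)) (cS * θ' ^ k) m :=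
    fun k j => by
      rw [← JsB12Sym0_S_eq_SrecOf hOdd N tabs cΛ cB (k + j), ← JsB12Sym0_S_eq_SrecOf hOdd N tabs cΛ cB k]
      exact locStencil_mono' (hSall0 k j) (mul_nonneg hcS0 (pow_nonneg hθS0 k)) (mul_pow_le_mul_pow hcS0 hθS0 (le_max_right _ _) k) hmδS
  -- the sup bound of the Hessian table, from its letter at rate 0
  obtain ⟨CH, hCH⟩ := tabs.hH 0 le_rfl
  have hHb : ∀ μ y x z a b, |tabs.H μ y x z a b| ≤ CH := fun μ y x z a b => by
    have h := hCH μ y x z a b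
    simpa using h
  have hSeq : (fun j => unitS (sfStep Lc j) (smStep 3 Lc j) (JsB12Sym0 hOdd N tabs cΛ cB j).S) = fun j =>
      unitS (sfStep Lc j) (smStep 3 Lc j) (SrecOf 3 Lc tabs.V tabs.H (Gsym Lc) ((Lc : ℝ) ^ 4) (-((Lc : ℝ) ^ 8 / 2)) cΛ j) :=
    funext fun j => by rw [JsB12Sym0_S_eq_SrecOf]
  rw [hSeq]
  exact limStOf_unitS_SrecOf_eq (d := 3) tabs.V tabs.H (Gsym Lc) ((Lc : ℝ) ^ 4) (-((Lc : ℝ) ^ 8 / 2)) cΛ hLc1 hVff hVmm hHfm hHm hHb hm hθ'0 hθ'1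
    hG' hGinf' hGrate' hK' hKinf' hKrate' hS0' hSall0'

/-! ## §2 (C2) The row's `S∞` is the (0.4) dressing of the undressed fixed point -/

/-- [our object] **(C2) THE PERFECT STENCIL OF THE LITERAL IS THE DRESSING OF THE UNDRESSED PERFECT STENCIL**: under the END's (CONV-C)-S rows,
`SPerfOf (sfStep Lc) (smStep 3 Lc) (fun j _ ↦ (JsB12Sym hOdd N tabs cΛ cB j).S) 1 = fun κ u ↦ dressKSymAt ρ_c Lc (coProjSymAtK ρ_c Lc S∞⁰ κ u)` with
`S∞⁰ := limStOf (j ↦ unitS_j (JsB12Sym0 … j).S)` the fixed point of (C1) (`SPerfOf_one`, `JsB12Sym = dressSymAt ρ_c ∘ JsB12Sym0` by `rfl`, the owner's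
`SymJetDressingUnits.limStOf_dressSym_unitS_eq` fed with asym1's `locStencil_limStOf`∕`locStencil_sub_limStOf`). -/
theorem SPerfOf_JsB12Sym_S_one_eq_dress (hOdd : Odd Lc) (N : ℕ) (tabs : SymTables 3 Lc) (cΛ cB : ℝ) {Cs0 cS δS θS : ℝ}
    (hS0 : ∀ j, LocStencil (unitS (sfStep Lc j) (smStep 3 Lc j) (JsB12Sym0 hOdd N tabs cΛ cB j).S) Cs0 δS)
    (hSall0 : ∀ k j, LocStencil (unitS (sfStep Lc (k + j)) (smStep 3 Lc (k + j)) (JsB12Sym0 hOdd N tabs cΛ cB (k + j)).S -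
      unitS (sfStep Lc k) (smStep 3 Lc k) (JsB12Sym0 hOdd N tabs cΛ cB k).S) (cS * θS ^ k) δS)
    (hδS : 0 < δS) (hθS0 : 0 ≤ θS) (hθS1 : θS < 1) :
    SPerfOf (sfStep Lc) (smStep 3 Lc) (fun j _ => (JsB12Sym hOdd N tabs cΛ cB j).S) 1 = fun κ u =>
      dressKSymAt (toSite (ctrOff 4 Lc)) Lc (coProjSymAtK (toSite (ctrOff 4 Lc)) Lc
        (limStOf (fun j => unitS (sfStep Lc j) (smStep 3 Lc j) (JsB12Sym0 hOdd N tabs cΛ cB j).S)) κ u) := by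
  have hLc1 : 1 ≤ Lc := Nat.one_le_iff_ne_zero.2 (NeZero.ne Lc)
  rw [SPerfOf_one (sfStep Lc) (smStep 3 Lc) (S1 := fun j => (JsB12Sym hOdd N tabs cΛ cB j).S) (fun j => rfl)]
  have hfam : (fun j => unitS (sfStep Lc j) (smStep 3 Lc j) (JsB12Sym hOdd N tabs cΛ cB j).S) = fun j =>
      unitS (sfStep Lc j) (smStep 3 Lc j) (fun κ u => dressKSymAt (toSite (ctrOff 4 Lc)) Lc
        (coProjSymAtK (toSite (ctrOff 4 Lc)) Lc (JsB12Sym0 hOdd N tabs cΛ cB j).S κ u)) := by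
    funext j
    have hS : (JsB12Sym hOdd N tabs cΛ cB j).S = fun κ u => dressKSymAt (toSite (ctrOff 4 Lc)) Lc
        (coProjSymAtK (toSite (ctrOff 4 Lc)) Lc (JsB12Sym0 hOdd N tabs cΛ cB j).S κ u) :=
      funext fun κ => funext fun u => by rw [JsB12Sym_apply, dressSymAt_S]
    rw [hS]
  rw [hfam]
  have hSi : LocStencil (limStOf (fun j => unitS (sfStep Lc j) (smStep 3 Lc j) (JsB12Sym0 hOdd N tabs cΛ cB j).S)) Cs0 δS :=
    locStencil_limStOf hS0 hSall0 hθS1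
  have hrate := locStencil_sub_limStOf (S := fun j => unitS (sfStep Lc j) (smStep 3 Lc j) (JsB12Sym0 hOdd N tabs cΛ cB j).S) hSall0 hθS1
  exact limStOf_dressSym_unitS_eq hLc1 (ctrOff_mem_box hLc1) (sfStep Lc) (smStep 3 Lc) hS0 hδS hSi hδS hrate hδS.le hθS0 hθS1

end Literal

end Summit.QuantumFields.BalabanUV.Beta.FP.PerfectStencilFixedPointSym

end
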